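import Literature.NumberTheory.EllipticCurves.AnticyclotomicSignedSelmer
import Summits.BirchSwinnertonDyer.BirchSwinnertonDyer.Theorems.QuadraticBranchSignedControlEtaLayerKummer
import Summits.BirchSwinnertonDyer.BirchSwinnertonDyer.Theorems.ResidualThetaTransportAtTwoRlfTwistedEventualLiftAtP
import HarnessLib

/-!
# Route `SignedLowerHalves`, crux L `SmallImageLowerHalfBothSigns` (stmt-BirchSwinnertonDyer-23599), line `rtt_w3` v11 — brick D3-W AT `p`, LAST STEP
# (memo `Lines/rtt_w3-MEMO-D3c-w3g17.md` §8 glue step (5)): from Kobayashi's signed Kummer condition at a FINITE layer `n` and at the PACKAGE's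
# embedding `ι : ℚ̄ → \bar{ℚ_{v₀}}` to INJ_top's condition above `p` — `AcSigned.condAbove W p κ v₀ (.sgn ε)` at `∞`-level, i.e. the `K_∞`-level
# signed Kummer condition at the DEFINITION's embedding `closureEmb ℚ_{v₀}` for EVERY `Γ_ℚ`-conjugate (`κ` cyclotomic, `v₀ ∋ p`).

Width seat `bsd-line-slh-p3-w3` g17 under LEAD `cruxlead-stmt-BirchSwinnertonDyer-23599` (cell `bsd-ssimc`; `--supports stmt-BirchSwinnertonDyer-23599 --as helper`).
THEOREMS ONLY (no definition, no named fact, no instance, no `sorry`); everything is a composition of tree lemmas: `AcSigned.map_resOfLe_localKummerOverOfEmb_le`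
and `AcSigned.localKummerOverOfEmb_signedLocalPointsOfEmb_le` (layer `n` → `∞`), `exists_algHom_eq_comp` + `EtaLayer.conjH1_mem_localKummerOverOfEmb_iff` +
`EtaLayer.signedLocalPointsOfEmb_comp` (change of embedding = one conjugation), `SignedEC.TwistedPT.conjH1_mem_localKummerOverOfEmb_iSup_signedLocalPoints`
(all conjugates; `p` totally ramified in `ℚ_∞`). BSD / crux L / INJ are NOT proved here.

* `signedLocalPointsInfty_comp` — `E^ε(ℚ_∞·E)` at `ι₀ ∘ τ` equals the one at `ι₀` (from `EtaLayer.signedLocalPointsOfEmb_comp`).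
* `conjH1_mem_signedKummerInfty_closureEmb_of_mem` — `c ∈ signedKummerInfty W p κ ι ε` for SOME `ℚ`-embedding `ι : ℚ̄ → \bar{E}` ⇒
  `conj_τ c ∈ signedKummerInfty W p κ (closureEmb E) ε` for the `τ` with `ι = closureEmb ∘ τ`.
* ★ `mem_condAbove_sgn_of_mem_signedKummerInfty` — (`κ` cyclotomic, `(p) ∈ v₀`): `c ∈ signedKummerInfty W p κ ι ε` for some
  `ι : ℚ̄ → \bar{ℚ_{v₀}}` ⇒ `c ∈ AcSigned.condAbove W p κ v₀ (.sgn ε)`.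
* ★★ `resOfLe_mem_condAbove_sgn_of_mem_layer` — the same from the LAYER-`n` condition: `z ∈ localKummerOverOfEmb W p (κ.layerSubgroup n) ι (E^ε(ℚ_n·ℚ_{v₀}))`
  ⇒ `resOfLe (ker κ ≤ Γ_{ℚ_n}) z ∈ AcSigned.condAbove W p κ v₀ (.sgn ε)` — the output of `…E1LocalCores*` feeds INJ_top's condition above `p`.

References: [Kobayashi2003] Def. 1.1; [BDKim2013] Def. 3.1/3.3; [SerreLocalFields1979] VII §5 Prop. 3; [SerreGaloisCohomology1997] II §1.1.
-/

set_option autoImplicit false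
set_option linter.dupNamespace false -- D-0017: single-problem summit, the namespace repeats the problem name by design
noncomputable section

open scoped Classical

namespace Summit.BirchSwinnertonDyer.BirchSwinnertonDyer.Theorems.SmallImageCharSignedSelmer

open NumberField IsDedekindDomain Field Literature.NumberTheory.EllipticCurves Literature.NumberTheory.GaloisRepresentations

universe u

/-! ## §1 Change of embedding at `∞`-level -/

section EmbChange

variable {K : Type u} [Field K] {p : ℕ} [Fact p.Prime] (κ : ZpExtension K p) {E : Type u} [Field E] [Algebra K E]
  (W : WeierstrassCurve K)

/-- `E^ε(K_∞·E)` does not depend on the embedding (layer subgroups are normal; `EtaLayer.signedLocalPointsOfEmb_comp`). [cite: Kobayashi2003, Def. 1.1] -/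
theorem signedLocalPointsInfty_comp (ι₀ : AlgebraicClosure K →ₐ[K] AlgebraicClosure E) (τ : AlgebraicClosure K ≃ₐ[K] AlgebraicClosure K) (ε : ℤˣ) :
    AcSigned.signedLocalPointsInfty κ (ι₀.comp (τ : AlgebraicClosure K →ₐ[K] AlgebraicClosure K)) W ε = AcSigned.signedLocalPointsInfty κ ι₀ W ε := by
  unfold AcSigned.signedLocalPointsInfty
  exact iSup_congr fun n ↦ EtaLayer.signedLocalPointsOfEmb_comp κ ι₀ τ ε n

/-- **One conjugation moves the condition to the chosen embedding**: if `c ∈ H¹(K_∞, E[p^∞])` satisfies the signed Kummer condition at SOME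
`K`-embedding `ι : K̄ → \bar{E}`, then for the `τ ∈ Γ_K` with `ι = closureEmb ∘ τ` (`exists_algHom_eq_comp`) the conjugate `conj_τ c` satisfies it at
`closureEmb E` (`EtaLayer.conjH1_mem_localKummerOverOfEmb_iff`). [cite: SerreGaloisCohomology1997, II §1.1] [cite: Kobayashi2003, Def. 1.1] -/
theorem conjH1_mem_signedKummerInfty_closureEmb_of_mem (ι : AlgebraicClosure K →ₐ[K] AlgebraicClosure E) (ε : ℤˣ)
    {c : W.subgroupH1 p κ.kerSubgroup} (hc : c ∈ AcSigned.signedKummerInfty W p κ ι ε) :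
    ∃ τ : AlgebraicClosure K ≃ₐ[K] AlgebraicClosure K, ι = (closureEmb (K := K) E).comp (τ : AlgebraicClosure K →ₐ[K] AlgebraicClosure K) ∧
      W.conjH1 p κ.kerSubgroup (show absoluteGaloisGroup K from τ) c ∈ AcSigned.signedKummerInfty W p κ (closureEmb (K := K) E) ε := by
  obtain ⟨τ, hτ⟩ := exists_algHom_eq_comp (closureEmb (K := K) E) ι
  refine ⟨τ, hτ, ?_⟩
  unfold AcSigned.signedKummerInfty at hc ⊢
  rw [EtaLayer.conjH1_mem_localKummerOverOfEmb_iff, ← signedLocalPointsInfty_comp κ W (closureEmb (K := K) E) τ ε, ← hτ]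
  exact hc

end EmbChange

/-! ## §2 Over `ℚ` with `κ` cyclotomic: all conjugates, and from a finite layer -/

section Rat

variable (W : WeierstrassCurve ℚ) {p : ℕ} [Fact p.Prime] (κ : ZpExtension ℚ p) (hκ : κ.IsCyclotomic) (v₀ : HeightOneSpectrum (𝓞 ℚ))
  (hv₀ : ((p : ℕ) : 𝓞 ℚ) ∈ v₀.asIdeal) (ε : ℤˣ)

include hκ hv₀ in
/-- ★ **INJ_top's condition above `p` from the signed Kummer condition at ANY embedding.** For `κ` cyclotomic and `(p) ∈ v₀`: if
`c ∈ H¹(ℚ_∞, E[p^∞])` lies in `signedKummerInfty W p κ ι ε` for some `ℚ`-embedding `ι : ℚ̄ → \bar{ℚ_{v₀}}`, then `c ∈ AcSigned.condAbove W p κ v₀ (.sgn ε)`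
(every conjugate satisfies the condition at `closureEmb ℚ_{v₀}`: one conjugation by §1, then all by the total ramification of `p` in `ℚ_∞`,
`SignedEC.TwistedPT.conjH1_mem_localKummerOverOfEmb_iSup_signedLocalPoints`). [cite: Kobayashi2003, Def. 1.1] [cite: SerreLocalFields1979, VII §5 Prop. 3] -/
theorem mem_condAbove_sgn_of_mem_signedKummerInfty (ι : AlgebraicClosure ℚ →ₐ[ℚ] AlgebraicClosure (v₀.adicCompletion ℚ))
    {c : W.subgroupH1 p κ.kerSubgroup} (hc : c ∈ AcSigned.signedKummerInfty W p κ ι ε) :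
    c ∈ AcSigned.condAbove W p κ v₀ (.sgn ε) := by
  obtain ⟨τ, -, hτc⟩ := conjH1_mem_signedKummerInfty_closureEmb_of_mem κ W ι ε hc
  rw [AcSigned.mem_condAbove_sgn_iff]
  intro σ
  have e : σ = (σ * (show absoluteGaloisGroup ℚ from τ)⁻¹) * (show absoluteGaloisGroup ℚ from τ) := by rw [inv_mul_cancel_right]
  rw [e, Literature.NumberTheory.EllipticCurves.conjH1_mul_holds κ.kerSubgroup (W.geomPrimaryTorsion p)
    (σ * (show absoluteGaloisGroup ℚ from τ)⁻¹) (show absoluteGaloisGroup ℚ from τ), AddMonoidHom.comp_apply]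
  exact SignedEC.TwistedPT.conjH1_mem_localKummerOverOfEmb_iSup_signedLocalPoints W κ hκ v₀ hv₀ ε hτc _

include hκ hv₀ in
/-- ★★ **From a finite layer.** If `z ∈ H¹(Γ_{ℚ_n}, E[p^∞])` satisfies Kobayashi's signed Kummer condition at layer `n` at some `ℚ`-embedding
`ι : ℚ̄ → \bar{ℚ_{v₀}}` (`z ∈ localKummerOverOfEmb W p (κ.layerSubgroup n) ι (E^ε(ℚ_n·ℚ_{v₀}))` — the output of `…E1LocalCores` /
`…E1LocalCoresClass` for `cor ξ`), then its restriction to `ℚ_∞` lies in `AcSigned.condAbove W p κ v₀ (.sgn ε)`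
(`AcSigned.map_resOfLe_localKummerOverOfEmb_le`, `AcSigned.localKummerOverOfEmb_signedLocalPointsOfEmb_le`, ★).
[cite: Kobayashi2003, Def. 1.1] [cite: BDKim2013, Def. 3.1 and Def. 3.3 (p. 193)] -/
theorem resOfLe_mem_condAbove_sgn_of_mem_layer (ι : AlgebraicClosure ℚ →ₐ[ℚ] AlgebraicClosure (v₀.adicCompletion ℚ)) (n : ℕ)
    {z : W.subgroupH1 p (κ.layerSubgroup n)}
    (hz : z ∈ Kobayashi2003.localKummerOverOfEmb W p (κ.layerSubgroup n) ι (Kobayashi2003.signedLocalPointsOfEmb κ ι W ε n)) :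
    W.resOfLe p (κ.kerSubgroup_le_layerSubgroup n) z ∈ AcSigned.condAbove W p κ v₀ (.sgn ε) :=
  mem_condAbove_sgn_of_mem_signedKummerInfty W κ hκ v₀ hv₀ ε ι
    (AcSigned.localKummerOverOfEmb_signedLocalPointsOfEmb_le W p κ ι ε n
      (AcSigned.map_resOfLe_localKummerOverOfEmb_le W p ι (κ.kerSubgroup_le_layerSubgroup n)
        (Kobayashi2003.signedLocalPointsOfEmb κ ι W ε n) (AddSubgroup.mem_map_of_mem _ hz)))

end Rat

end Summit.BirchSwinnertonDyer.BirchSwinnertonDyer.Theorems.SmallImageCharSignedSelmer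

end
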